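import Mathlib
import Summits.Ventures.PercRepro2.Defs
import Summits.Ventures.PercRepro2.Graph
import Summits.Ventures.PercRepro2.Harris
import Summits.Ventures.PercRepro2.Independence
import Summits.Ventures.PercRepro2.RowC1Cross
import Summits.Ventures.PercRepro2.PendantRoot
import Summits.Ventures.PercRepro2.PsiTEdge

/-!
# The cross term of row 2′C1 at the edge of a leaf mark equals the merged world's row
(blind cell PercRepro2, p2 g34; proofs/P2-G34-ROOT.md §16)

If the mark `b` is a LEAF with `e = bw` its only edge, then pinning `e` closed isolates `b`
(`P⁰(Q, bH) = P⁰(Q, oU, bU) = 0`), while `Q` and `{o ∈ U}` do not depend on `e` (the cell's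
`PendantRoot.free_connEvent`), so the cross term collapses to the row of the open pin:
`c1Cross p e = c1Slack p[e↦1]` (`c1Cross_eq_of_leaf_b`).  Symmetrically for a leaf `o` with
`e = ow` (`c1Cross_eq_of_leaf_o`).  Hence at such an edge the cross term is nonnegative as soon as
the row holds for the open pin — the induction of `c1Slack_nonneg_of_cross` passes through leaf
marks for free.  Std axioms.
-/

namespace Summit.Ventures.PercRepro2

namespace RowC1

section Leaf

variable {V : Type*} {E : Type*} [Fintype E] [DecidableEq E] [Fintype V] [DecidableEq V]
  {R : Type*} [Field R] [LinearOrder R] [IsStrictOrderedRing R]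

omit [Fintype V] [DecidableEq V] [LinearOrder R] [IsStrictOrderedRing R] in
/-- A free event has the same probability with `e` pinned open and pinned closed. -/
lemma prob_update_one_eq_update_zero_of_free (p : E → R) (e : E) {A : Set (Config E)}
    (hA : PendantRoot.Free e A) :
    prob (Function.update p e (1 : R)) A = prob (Function.update p e (0 : R)) A := by
  refine prob_update_one_eq_prob_update_zero_of_respects p e fun ω _ _ => ?_
  refine dependsOn_mem_iff hA fun f hf => ?_
  have hfe : f ≠ e := by simpa using hf
  simp [Function.update_of_ne hfe]

omit [Fintype E] [DecidableEq E] [Fintype V] [DecidableEq V] [Field R] [LinearOrder R]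
  [IsStrictOrderedRing R] in
/-- Free events are closed under union. -/
lemma Free.union' {e : E} {A B : Set (Config E)} (hA : PendantRoot.Free e A)
    (hB : PendantRoot.Free e B) : PendantRoot.Free e (A ∪ B) := by
  have := dependsOn_union hA hB
  rwa [Set.union_self] at this

omit [Fintype E] [DecidableEq E] [Fintype V] [DecidableEq V] [Field R] [LinearOrder R]
  [IsStrictOrderedRing R] in
/-- `(openEdge e ∩ X) ∩ Q = (X ∩ Q) ∩ openEdge e`. -/
lemma inter_openEdge_rearrange (e : E) (X Q : Set (Config E)) :
    (openEdge e ∩ X) ∩ Q = (X ∩ Q) ∩ openEdge e := by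
  ext ω; simp only [Set.mem_inter_iff]; tauto

omit [Fintype V] [DecidableEq V] [LinearOrder R] [IsStrictOrderedRing R] in
/-- **Leaf `b`**: with `e = bw` the only edge of `b`, `c1Cross p e = c1Slack p[e↦1]`. -/
theorem c1Cross_eq_of_leaf_b (p : E → R) (ends : E → Sym2 V) {e : E} {b w : V}
    (hends : ends e = s(b, w)) (hleaf : ∀ f, b ∈ ends f → f = e) (hbw : b ≠ w)
    {a₁ a₂ o : V} (hb1 : b ≠ a₁) (hb2 : b ≠ a₂) (hbo : b ≠ o) :
    c1Cross p ends a₁ a₂ o b e = c1Slack (Function.update p e (1 : R)) ends a₁ a₂ o b := by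
  have hQ : PendantRoot.Free e (connEvent ends a₁ a₂)ᶜ :=
    (PendantRoot.free_connEvent hends hleaf hbw hb1.symm hb2.symm).compl
  have hoU : PendantRoot.Free e (connEvent ends a₁ o ∪ connEvent ends a₂ o) :=
    Free.union' (PendantRoot.free_connEvent hends hleaf hbw hb1.symm hbo.symm)
      (PendantRoot.free_connEvent hends hleaf hbw hb2.symm hbo.symm)
  have hA := prob_update_one_eq_update_zero_of_free p e hQ
  have hD := prob_update_one_eq_update_zero_of_free p e (hoU.inter hQ)
  have h2b : connEvent ends a₂ b = openEdge e ∩ connEvent ends a₂ w :=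
    PendantRoot.connEvent_other_leaf hends hleaf hbw hb2
  have h1b : connEvent ends a₁ b = openEdge e ∩ connEvent ends a₁ w :=
    PendantRoot.connEvent_other_leaf hends hleaf hbw hb1
  have hC0 : prob (Function.update p e (0 : R)) (connEvent ends a₂ b ∩ (connEvent ends a₁ a₂)ᶜ) = 0 := by
    rw [h2b, inter_openEdge_rearrange, prob_update_zero_inter_openEdge]
  have hB0 : prob (Function.update p e (0 : R))
      ((connEvent ends a₁ o ∪ connEvent ends a₂ o) ∩
        (connEvent ends a₁ b ∪ connEvent ends a₂ b) ∩ (connEvent ends a₁ a₂)ᶜ) = 0 := by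
    have hset : (connEvent ends a₁ o ∪ connEvent ends a₂ o) ∩
        (connEvent ends a₁ b ∪ connEvent ends a₂ b) ∩ (connEvent ends a₁ a₂)ᶜ =
        ((connEvent ends a₁ o ∪ connEvent ends a₂ o) ∩
          (connEvent ends a₁ w ∪ connEvent ends a₂ w) ∩ (connEvent ends a₁ a₂)ᶜ) ∩ openEdge e := by
      rw [h1b, h2b]; ext ω; simp only [Set.mem_inter_iff, Set.mem_union]; tauto
    rw [hset, prob_update_zero_inter_openEdge]
  unfold c1Cross c1Slack
  rw [hA, hD, hC0, hB0]
  ring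

omit [Fintype V] [DecidableEq V] [LinearOrder R] [IsStrictOrderedRing R] in
/-- **Leaf `o`**: with `e = ow` the only edge of `o`, `c1Cross p e = c1Slack p[e↦1]`. -/
theorem c1Cross_eq_of_leaf_o (p : E → R) (ends : E → Sym2 V) {e : E} {o w : V}
    (hends : ends e = s(o, w)) (hleaf : ∀ f, o ∈ ends f → f = e) (how : o ≠ w)
    {a₁ a₂ b : V} (ho1 : o ≠ a₁) (ho2 : o ≠ a₂) (hob : o ≠ b) :
    c1Cross p ends a₁ a₂ o b e = c1Slack (Function.update p e (1 : R)) ends a₁ a₂ o b := by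
  have hQ : PendantRoot.Free e (connEvent ends a₁ a₂)ᶜ :=
    (PendantRoot.free_connEvent hends hleaf how ho1.symm ho2.symm).compl
  have hbH : PendantRoot.Free e (connEvent ends a₂ b ∩ (connEvent ends a₁ a₂)ᶜ) :=
    (PendantRoot.free_connEvent hends hleaf how ho2.symm hob.symm).inter hQ
  have hA := prob_update_one_eq_update_zero_of_free p e hQ
  have hC := prob_update_one_eq_update_zero_of_free p e hbH
  have h1o : connEvent ends a₁ o = openEdge e ∩ connEvent ends a₁ w :=
    PendantRoot.connEvent_other_leaf hends hleaf how ho1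
  have h2o : connEvent ends a₂ o = openEdge e ∩ connEvent ends a₂ w :=
    PendantRoot.connEvent_other_leaf hends hleaf how ho2
  have hD0 : prob (Function.update p e (0 : R))
      ((connEvent ends a₁ o ∪ connEvent ends a₂ o) ∩ (connEvent ends a₁ a₂)ᶜ) = 0 := by
    have hset : (connEvent ends a₁ o ∪ connEvent ends a₂ o) ∩ (connEvent ends a₁ a₂)ᶜ =
        ((connEvent ends a₁ w ∪ connEvent ends a₂ w) ∩ (connEvent ends a₁ a₂)ᶜ) ∩ openEdge e := by
      rw [h1o, h2o]; ext ω; simp only [Set.mem_inter_iff, Set.mem_union]; tauto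
    rw [hset, prob_update_zero_inter_openEdge]
  have hB0 : prob (Function.update p e (0 : R))
      ((connEvent ends a₁ o ∪ connEvent ends a₂ o) ∩
        (connEvent ends a₁ b ∪ connEvent ends a₂ b) ∩ (connEvent ends a₁ a₂)ᶜ) = 0 := by
    have hset : (connEvent ends a₁ o ∪ connEvent ends a₂ o) ∩
        (connEvent ends a₁ b ∪ connEvent ends a₂ b) ∩ (connEvent ends a₁ a₂)ᶜ =
        ((connEvent ends a₁ w ∪ connEvent ends a₂ w) ∩
          (connEvent ends a₁ b ∪ connEvent ends a₂ b) ∩ (connEvent ends a₁ a₂)ᶜ) ∩ openEdge e := by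
      rw [h1o, h2o]; ext ω; simp only [Set.mem_inter_iff, Set.mem_union]; tauto
    rw [hset, prob_update_zero_inter_openEdge]
  unfold c1Cross c1Slack
  rw [hA, hC, hD0, hB0]
  ring

omit [Fintype V] [DecidableEq V] [IsStrictOrderedRing R] in
/-- At the edge of a leaf mark the cross term is nonnegative as soon as the row holds for the open
pin (leaf `b`). -/
theorem c1Cross_nonneg_of_leaf_b (p : E → R) (ends : E → Sym2 V) {e : E} {b w : V}
    (hends : ends e = s(b, w)) (hleaf : ∀ f, b ∈ ends f → f = e) (hbw : b ≠ w)
    {a₁ a₂ o : V} (hb1 : b ≠ a₁) (hb2 : b ≠ a₂) (hbo : b ≠ o)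
    (h1 : 0 ≤ c1Slack (Function.update p e (1 : R)) ends a₁ a₂ o b) :
    0 ≤ c1Cross p ends a₁ a₂ o b e := by
  rw [c1Cross_eq_of_leaf_b p ends hends hleaf hbw hb1 hb2 hbo]; exact h1

omit [Fintype V] [DecidableEq V] [IsStrictOrderedRing R] in
/-- At the edge of a leaf mark the cross term is nonnegative as soon as the row holds for the open
pin (leaf `o`). -/
theorem c1Cross_nonneg_of_leaf_o (p : E → R) (ends : E → Sym2 V) {e : E} {o w : V}
    (hends : ends e = s(o, w)) (hleaf : ∀ f, o ∈ ends f → f = e) (how : o ≠ w)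
    {a₁ a₂ b : V} (ho1 : o ≠ a₁) (ho2 : o ≠ a₂) (hob : o ≠ b)
    (h1 : 0 ≤ c1Slack (Function.update p e (1 : R)) ends a₁ a₂ o b) :
    0 ≤ c1Cross p ends a₁ a₂ o b e := by
  rw [c1Cross_eq_of_leaf_o p ends hends hleaf how ho1 ho2 hob]; exact h1

end Leaf

end RowC1

end Summit.Ventures.PercRepro2
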